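import Summits.ResolutionOfSingularities.ResolutionOfSingularities.Theorems.FrobeniusLadderFInjectiveMacaulayficationFedderCriterion
import Summits.ResolutionOfSingularities.ResolutionOfSingularities.Theorems.FrobeniusLadderFInjectiveMacaulayficationCIFedderClosure
import HarnessLib

/-!
# Fedder's criterion for complete intersections, NECESSITY, in Frobenius-closure form — and the full CI criterion

Support file for crux stmt-ResolutionOfSingularities-15315 (`FrobeniusLadder.FInjectiveMacaulayfication`), chain w45a,
seat res-L1-w45a-stub-2 g13 (res-L1-w45a-plan-1 RULING R23.11 (1)/(2): the input and floor NOT-FULL columns of the first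
non-hypersurface census row need Fedder's NECESSITY for a complete intersection at a point where EVERY local equation is
singular — `…CIFedderClosure.lean` proved sufficiency only and recorded «NOT claimed: the necessity direction for complete
intersections»; `…PencilFedderNotFullCI.lean` needs one equation regular at the point). [OURS · L1 W4.5a] — NOT a statement of
the manuscript [claim: Hironaka2017]; AI-written, weaker than expert review. Nothing of the crux is proved.

Let `(R, 𝔪)` be a regular local ring of prime characteristic `p` and `gs ⊆ 𝔪` a finite list of the expected codimension
(`dim R⧸(gs) + |gs| = dim R`, so `gs` is part of a system of parameters, i.e. a regular sequence).

* §1 `radical_ofList_eq_of_forall_mem` — bookkeeping: two lists generate ideals with the same radical once each member of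
  either is in the radical of the other.
* §2 ★ `mem_ofList_of_prod_pow_mul_mem` — THE ITERATED COLON in a local ring all of whose systems of parameters are weakly
  regular (Cohen–Macaulay in the route's currency): if `pre ++ post ⊆ 𝔪` is a system of parameters (`|pre| + |post| = dim R`,
  `rad (pre ++ post) = 𝔪`) and `(∏ pre)^a · z ∈ (x^(a+1) : x ∈ pre) + (post)`, then `z ∈ (pre) + (post)`. Induction on `pre`:
  `g^a · w ∈ (g^(a+1)) + K` gives `g^a (w − c g) ∈ K`, and `g^a` is a non-zero-divisor modulo the parameter ideal `K`
  (colon capturing, ✓ `Exchange.mem_span_of_mul_mem`), so `w ∈ (g) + K` — the monomial-ideal identity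
  `((g₁^(a+1), …, g_r^(a+1), post) : (g₁⋯g_r)^a) = (g₁, …, g_r, post)` for a system of parameters, proved without Koszul
  complexes or linkage.
* §3 ★★ `not_frobeniusClosed_of_ci_fedder_mem` — **NECESSITY**: if `(∏ gs)^(p-1) ∈ 𝔪^[p]` then `R ⧸ (gs)` has a system of
  parameters `t̄` whose ideal is NOT Frobenius closed (some `ȳ ∉ (t̄)` with `ȳ^p ∈ (t̄)^[p]`) — so `R ⧸ (gs)` is not
  F-injective and violates the per-stalk clause of the crux. Argument (the hypersurface argument of ✓ `Fedder.not_frobeniusClosed_of_fedder_mem`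
  with §2 in place of one colon capture): lift a system of parameters `t̄` of `R⧸(gs)` to `t`; `I = (gs, t)` is `𝔪`-primary; a socle
  element `s ∉ I`, `𝔪 s ⊆ I` has `(∏ gs)^(p-1) s^p ∈ (𝔪 s)^[p] ⊆ I^[p] = (g^p : g ∈ gs) + (t^p)`, so §2 (with `post = t^p`) gives
  `s^p ∈ (gs) + (t^p)`; downstairs `s̄^p ∈ (t̄)^[p]`, `s̄ ∉ (t̄)`. No F-finiteness, no local cohomology.
* §4 ★★ `ci_fedder_clause_iff` — **FEDDER'S CRITERION FOR COMPLETE INTERSECTIONS** (both directions, closure form): under the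
  expected-codimension hypothesis, `R ⧸ (gs)` satisfies the per-stalk clause of `FInjectiveMacaulayfication` (every system of
  parameters weakly regular, every parameter ideal Frobenius closed) **iff** `(∏ gs)^(p-1) ∉ 𝔪^[p]` (`⇐` ✓ `CIFedder.fedder_ci_clause`);
  `not_clause_of_ringEquiv_of_ci_fedder_mem` — the negative half transported to any ring isomorphic to `R ⧸ (gs)`.

References: [Fedder1983] R. Fedder, F-purity and rational singularity, Trans. AMS 278 (1983), Prop. 1.7, Thm. 1.12, Prop. 2.1;
[Matsumura1987] Thm. 17.4. No definitions, no named facts. [folklore]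
-/

-- single-problem summit: the doubled namespace component is forced
set_option linter.dupNamespace false

namespace Summit.ResolutionOfSingularities.ResolutionOfSingularities.Theorems.FInjectiveMacaulayfication.CIFedderNecessity

open IsLocalRing RingTheory.Sequence Literature.RingTheory.TightClosure
  Literature.AlgebraicGeometry.Resolution
  Summit.ResolutionOfSingularities.ResolutionOfSingularities.Theorems.FRationalModification
  Summit.ResolutionOfSingularities.ResolutionOfSingularities.Theorems.FInjectiveMacaulayfication

variable {R : Type*} [CommRing R]

/-! ## §1 Bookkeeping on ideals of lists -/

/-- A member of a list lies in the ideal the list generates. [folklore] -/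
theorem mem_ofList_of_mem {L : List R} {x : R} (hx : x ∈ L) : x ∈ Ideal.ofList L :=
  Ideal.subset_span hx

/-- Lists with the same members generate the same ideal. [folklore] -/
theorem ofList_eq_of_forall_mem_iff {L₁ L₂ : List R} (h : ∀ x, x ∈ L₁ ↔ x ∈ L₂) :
    Ideal.ofList L₁ = Ideal.ofList L₂ :=
  congrArg Ideal.span (Set.ext fun x => h x)

/-- Two lists generate ideals with the same radical as soon as each member of either list lies in the radical of the ideal
of the other. [folklore] -/
theorem radical_ofList_eq_of_forall_mem {L₁ L₂ : List R} (h₁ : ∀ x ∈ L₁, x ∈ (Ideal.ofList L₂).radical)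
    (h₂ : ∀ x ∈ L₂, x ∈ (Ideal.ofList L₁).radical) :
    (Ideal.ofList L₁).radical = (Ideal.ofList L₂).radical :=
  le_antisymm (Ideal.radical_le_radical_iff.mpr (Ideal.span_le.mpr fun x hx => h₁ x hx))
    (Ideal.radical_le_radical_iff.mpr (Ideal.span_le.mpr fun x hx => h₂ x hx))

/-! ## §2 ★ The iterated colon in a Cohen–Macaulay local ring -/

/-- ★ **THE ITERATED COLON.** Let `(R, 𝔪)` be a local ring in which every system of parameters is a weakly regular sequence,
and `pre ++ post ⊆ 𝔪` a system of parameters (`dim R = |pre| + |post|`, `rad (pre ++ post) = 𝔪`). If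
`(∏ pre)^a · z ∈ (x^(a+1) : x ∈ pre) + (post)` for some `a ≥ 1`, then `z ∈ (pre) + (post)`. (Induction on `pre`, one colon
capture `Exchange.mem_span_of_mul_mem` per member: `g^a` is a non-zero-divisor modulo the parameter ideal generated by the
other powers and `post`.) [folklore; cite: Matsumura1987, Thm. 17.4] -/
theorem mem_ofList_of_prod_pow_mul_mem [IsLocalRing R]
    (hCM : ∀ ⦃n : ℕ⦄ (s : Fin n → R), IsSystemOfParameters s → IsWeaklyRegular R (List.ofFn s))
    {a : ℕ} (ha : 0 < a) :
    ∀ (pre post : List R), (∀ x ∈ pre ++ post, x ∈ maximalIdeal R) →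
      ringKrullDim R = ((pre ++ post).length : WithBot ℕ∞) →
      (Ideal.ofList (pre ++ post)).radical = maximalIdeal R →
      ∀ z : R, pre.prod ^ a * z ∈ Ideal.ofList (pre.map (fun x => x ^ (a + 1)) ++ post) →
        z ∈ Ideal.ofList (pre ++ post) := by
  intro pre
  induction pre with
  | nil =>
    intro post _ _ _ z hz
    simpa only [List.prod_nil, one_pow, one_mul, List.map_nil, List.nil_append] using hz
  | cons g pre ih =>
    intro post hmem hdim hrad z hz
    -- unpack `(g ∏ pre)^a z ∈ (g^(a+1)) + K`, `K = (x^(a+1) : x ∈ pre) + (post)`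
    set K : Ideal R := Ideal.ofList (pre.map (fun x => x ^ (a + 1)) ++ post) with hK
    have hz' : (g * pre.prod) ^ a * z ∈ Ideal.span {g ^ (a + 1)} ⊔ K := by
      have h := hz
      rw [List.map_cons, List.cons_append, Ideal.ofList_cons, List.prod_cons] at h
      exact h
    obtain ⟨c, κ, hκ, hsum⟩ := Ideal.mem_span_singleton_sup.mp hz'
    set w : R := pre.prod ^ a * z with hw
    have hcol : g ^ a * (w - c * g) ∈ K := by
      have e : g ^ a * (w - c * g) = κ := by
        rw [hw, eq_sub_of_add_eq' hsum]
        ring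
      rw [e]
      exact hκ
    -- the colon capture: `g^a` is regular modulo the parameter ideal `K`
    set u : Fin (pre.map (fun x => x ^ (a + 1)) ++ post).length → R :=
      (pre.map (fun x => x ^ (a + 1)) ++ post).get with hu
    have hKu : K = Ideal.span (Set.range u) := by
      rw [hK, hu, CIChartCore.ofList_eq_span_range_get]
    have hd : ringKrullDim R = (((pre.map (fun x => x ^ (a + 1)) ++ post).length + 1 : ℕ) : WithBot ℕ∞) := by
      rw [hdim]
      simp only [List.cons_append, List.length_cons, List.length_append, List.length_map]
    have hgmem : g ∈ Ideal.ofList (g :: pre ++ post) := mem_ofList_of_mem (by simp)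
    have hrad' : (Ideal.span (insert (g ^ a) (Set.range u))).radical = maximalIdeal R := by
      rw [Ideal.span_insert, ← hKu, hK, ← Ideal.ofList_cons, ← hrad]
      refine radical_ofList_eq_of_forall_mem ?_ ?_
      · intro x hx
        rcases List.mem_cons.mp hx with rfl | hx
        · exact Ideal.le_radical (Ideal.pow_mem_of_mem _ hgmem a ha)
        rcases List.mem_append.mp hx with hx | hx
        · obtain ⟨y, hy, rfl⟩ := List.mem_map.mp hx
          exact Ideal.le_radical (Ideal.pow_mem_of_mem _ (mem_ofList_of_mem (by simp [hy])) _ (Nat.succ_pos a))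
        · exact Ideal.le_radical (mem_ofList_of_mem (by simp [hx]))
      · intro x hx
        rcases List.mem_cons.mp hx with rfl | hx
        · exact ⟨a, mem_ofList_of_mem (by simp)⟩
        rcases List.mem_append.mp hx with hx | hx
        · exact ⟨a + 1, mem_ofList_of_mem (List.mem_cons_of_mem _
            (List.mem_append.mpr (Or.inl (List.mem_map.mpr ⟨x, hx, rfl⟩))))⟩
        · exact ⟨1, by rw [pow_one]; exact mem_ofList_of_mem (by simp [hx])⟩
    have hcap : w - c * g ∈ K := by
      rw [hKu]
      exact Exchange.mem_span_of_mul_mem hCM hd hrad' (by rw [← hKu]; exact hcol)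
    -- so `w ∈ (x^(a+1) : x ∈ pre) + (g :: post)`
    have hT : w ∈ Ideal.ofList (pre.map (fun x => x ^ (a + 1)) ++ g :: post) := by
      have hle : K ≤ Ideal.ofList (pre.map (fun x => x ^ (a + 1)) ++ g :: post) := by
        refine Ideal.span_mono fun x hx => ?_
        simp only [Set.mem_setOf_eq, List.mem_append, List.mem_cons] at hx ⊢
        tauto
      have h := add_mem (hle hcap) (Ideal.mul_mem_left _ c
        (mem_ofList_of_mem (L := pre.map (fun x => x ^ (a + 1)) ++ g :: post) (x := g) (by simp)))
      rwa [sub_add_cancel] at h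
    -- induction hypothesis with `post := g :: post`
    have hperm : ∀ x, x ∈ pre ++ g :: post ↔ x ∈ g :: pre ++ post := fun x => by
      simp only [List.mem_append, List.mem_cons, List.cons_append]
      tauto
    have h := ih (g :: post) (fun x hx => hmem x ((hperm x).mp hx))
      (by rw [hdim]; simp only [List.length_append, List.length_cons, List.cons_append]; push_cast; ring)
      (by rw [ofList_eq_of_forall_mem_iff hperm, hrad]) z hT
    rwa [ofList_eq_of_forall_mem_iff hperm] at h

/-! ## §3 ★★ Necessity of Fedder's condition for complete intersections -/

section Necessity

variable (p : ℕ) [Fact p.Prime] [CharP R p] [IsRegularLocalRing R]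

omit [IsRegularLocalRing R] in
/-- The Frobenius power of `(gs) + (t)` is generated by the `p`-th powers of the members of the list `gs` and of the tuple
`t`: `((gs) ⊔ (t))^[p] = (g^p : g ∈ gs) + (tᵢ^p)`. [folklore] -/
theorem frobeniusPower_ofList_sup_span {n : ℕ} (gs : List R) (t : Fin n → R) :
    frobeniusPower p (Ideal.ofList gs ⊔ Ideal.span (Set.range t)) =
      Ideal.ofList (gs.map (fun x => x ^ ((p - 1) + 1)) ++ List.ofFn fun i => t i ^ p) := by
  have hp1 : p - 1 + 1 = p := Nat.sub_add_cancel (Fact.out : p.Prime).one_lt.le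
  rw [hp1, Ideal.ofList_append, Exchange.ofList_ofFn]
  change frobeniusPower p (Ideal.span {r | r ∈ gs} ⊔ Ideal.span (Set.range t)) = _
  rw [← Ideal.span_union]
  have h := frobeniusPower_span (R := R) p 1 ({r | r ∈ gs} ∪ Set.range t)
  rw [pow_one] at h
  rw [h, Set.image_union, Ideal.span_union, ← Set.range_comp]
  congr 2
  ext x
  simp only [Set.mem_image, Set.mem_setOf_eq, List.mem_map]

/-- ★★ **FEDDER'S CRITERION FOR COMPLETE INTERSECTIONS, NECESSITY, closure form.** Let `(R, 𝔪)` be a regular local ring of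
characteristic `p` and `gs ⊆ 𝔪` a finite list with `dim R⧸(gs) + |gs| = dim R` and `(∏ gs)^(p-1) ∈ 𝔪^[p]`. Then `R ⧸ (gs)` has a
system of parameters `t̄` (of length `dim R⧸(gs)`, radical maximal) whose ideal is NOT Frobenius closed: some `ȳ ∉ (t̄)` has
`ȳ^p ∈ (t̄)^[p]` — `R ⧸ (gs)` is not F-injective and violates the per-stalk clause of crux `FInjectiveMacaulayfication`.
(`ȳ` is the class of a socle element of `(gs, t)`; see the module docstring.) [cite: Fedder1983, Thm. 1.12 and Prop. 2.1] -/
theorem not_frobeniusClosed_of_ci_fedder_mem (gs : List R) (hgs : ∀ g ∈ gs, g ∈ maximalIdeal R)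
    (hdim : ringKrullDim (R ⧸ Ideal.ofList gs) + (gs.length : WithBot ℕ∞) = ringKrullDim R)
    (hfed : gs.prod ^ (p - 1) ∈ frobeniusPower p (maximalIdeal R)) :
    ∃ (n : ℕ) (t : Fin n → R ⧸ Ideal.ofList gs), ringKrullDim (R ⧸ Ideal.ofList gs) = n ∧
      (Ideal.span (Set.range t)).radical.IsMaximal ∧
      ∃ y : R ⧸ Ideal.ofList gs, (∃ e : ℕ, y ^ p ^ e ∈
          Ideal.span ((fun z : R ⧸ Ideal.ofList gs => z ^ p ^ e) ''
            (Ideal.span (Set.range t) : Set (R ⧸ Ideal.ofList gs)))) ∧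
        y ∉ Ideal.span (Set.range t) := by
  have hp : p.Prime := Fact.out
  have hp1 : 0 < p - 1 := Nat.sub_pos_of_lt hp.one_lt
  have hp1' : p - 1 + 1 = p := Nat.sub_add_cancel hp.one_lt.le
  obtain ⟨-, hnt, hloc⟩ := CIChartCore.isLocalRing_quotient_ofList gs hgs
  set mk := Ideal.Quotient.mk (Ideal.ofList gs) with hmk
  -- `R` is Cohen–Macaulay: every system of parameters is weakly regular
  have hCM : ∀ ⦃m : ℕ⦄ (s : Fin m → R), IsSystemOfParameters s → IsWeaklyRegular R (List.ofFn s) :=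
    fun m s hs => SopWeaklyRegular.stub_sopWeaklyRegular (exists_isRegular_length_eq_ringKrullDim R) s hs
  -- dimensions: `dim R/(gs) = n`, `dim R = |gs| + n`
  obtain ⟨n, hn⟩ := exists_nat_cast_eq_ringKrullDim (R := R ⧸ Ideal.ofList gs)
  have hdimR : ringKrullDim R = ((gs.length + n : ℕ) : WithBot ℕ∞) := by
    rw [← hdim, hn]
    push_cast
    ring
  -- a system of parameters `t̄` of `R/(gs)` and a lift `t`
  obtain ⟨t', ht'⟩ := exists_isSystemOfParameters (R := R ⧸ Ideal.ofList gs) hn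
  obtain ⟨t, ht⟩ : ∃ t : Fin n → R, ∀ i, mk (t i) = t' i :=
    ⟨fun i => (Ideal.Quotient.mk_surjective (t' i)).choose,
      fun i => (Ideal.Quotient.mk_surjective (t' i)).choose_spec⟩
  -- the parameter ideal `I = (gs, t)` of `R`
  set I : Ideal R := Ideal.ofList gs ⊔ Ideal.span (Set.range t) with hI
  have hmapI : I.map mk = Ideal.span (Set.range t') := by
    rw [hI, Ideal.map_sup, hmk, Ideal.map_quotient_self, bot_sup_eq, Ideal.map_span, ← Set.range_comp]
    have hcomp : (Ideal.Quotient.mk (Ideal.ofList gs) ∘ t) = t' := funext ht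
    rw [hcomp]
  have hkerI : RingHom.ker mk ≤ I := by
    rw [hmk, Ideal.mk_ker]
    exact le_sup_left
  have hcomapI : (Ideal.span (Set.range t')).comap mk = I := by
    rw [← hmapI, Ideal.comap_map_of_surjective mk Ideal.Quotient.mk_surjective,
      ← RingHom.ker_eq_comap_bot, sup_eq_left.mpr hkerI]
  have hradI : I.radical = maximalIdeal R := by
    have h1 : ((Ideal.span (Set.range t')).radical).comap mk = maximalIdeal R :=
      eq_maximalIdeal (ht'.2.symm ▸ Ideal.comap_isMaximal_of_surjective mk Ideal.Quotient.mk_surjective)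
    rw [← hcomapI, ← Ideal.comap_radical, h1]
  have hItop : I ≠ ⊤ := by
    intro h
    have h1 : I.radical = ⊤ := by rw [h, Ideal.radical_top]
    exact (maximalIdeal.isMaximal R).ne_top (hradI ▸ h1)
  have htm : ∀ i, t i ∈ maximalIdeal R := fun i =>
    hradI ▸ Ideal.le_radical (Ideal.mem_sup_right (Ideal.subset_span ⟨i, rfl⟩))
  -- a socle element `s` of `I`
  obtain ⟨s, hsI, hsoc⟩ := Fedder.exists_socle_of_le_radical hItop hradI.symm.le
  -- `(∏ gs)^(p-1) s^p ∈ I^[p] = (g^p : g ∈ gs) + (t^p)`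
  have hmem : gs.prod ^ (p - 1) * s ^ p ∈ frobeniusPower p I := by
    have key : ∀ g ∈ frobeniusPower p (maximalIdeal R), g * s ^ p ∈ frobeniusPower p I := by
      intro g hg
      induction hg using Submodule.span_induction with
      | mem x hx =>
        obtain ⟨m, hm, rfl⟩ := hx
        change m ^ p * s ^ p ∈ frobeniusPower p I
        rw [← mul_pow]
        exact pow_mem_frobeniusPower (hsoc m hm)
      | zero => rw [zero_mul]; exact zero_mem _
      | add x y _ _ hx hy => rw [add_mul]; exact add_mem hx hy
      | smul r x _ hx => rw [smul_eq_mul, mul_assoc]; exact Ideal.mul_mem_left _ r hx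
    exact key _ hfed
  rw [hI, frobeniusPower_ofList_sup_span p gs t] at hmem
  -- the iterated colon: `s^p ∈ (gs) + (t^p)`
  set tp : List R := List.ofFn fun i => t i ^ p with htp
  have hmem' : ∀ x ∈ gs ++ tp, x ∈ maximalIdeal R := by
    intro x hx
    rcases List.mem_append.mp hx with hx | hx
    · exact hgs x hx
    · rw [htp, List.mem_ofFn'] at hx
      obtain ⟨i, rfl⟩ := hx
      exact Ideal.pow_mem_of_mem _ (htm i) p hp.pos
  have hlen : ringKrullDim R = ((gs ++ tp).length : WithBot ℕ∞) := by
    rw [hdimR, List.length_append, htp, List.length_ofFn]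
  have hrad : (Ideal.ofList (gs ++ tp)).radical = maximalIdeal R := by
    rw [← hradI, hI, ← Exchange.ofList_ofFn t, ← Ideal.ofList_append]
    refine radical_ofList_eq_of_forall_mem ?_ ?_
    · intro x hx
      rcases List.mem_append.mp hx with hx | hx
      · exact Ideal.le_radical (mem_ofList_of_mem (List.mem_append.mpr (Or.inl hx)))
      · rw [htp, List.mem_ofFn'] at hx
        obtain ⟨i, rfl⟩ := hx
        exact Ideal.le_radical (Ideal.pow_mem_of_mem _
          (mem_ofList_of_mem (List.mem_append.mpr (Or.inr ((List.mem_ofFn' _ _).mpr ⟨i, rfl⟩)))) p hp.pos)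
    · intro x hx
      rcases List.mem_append.mp hx with hx | hx
      · exact Ideal.le_radical (mem_ofList_of_mem (List.mem_append.mpr (Or.inl hx)))
      · rw [List.mem_ofFn'] at hx
        obtain ⟨i, rfl⟩ := hx
        exact ⟨p, mem_ofList_of_mem (List.mem_append.mpr (Or.inr (by
          rw [htp, List.mem_ofFn']; exact ⟨i, rfl⟩)))⟩
  have hsp : s ^ p ∈ Ideal.ofList (gs ++ tp) :=
    mem_ofList_of_prod_pow_mul_mem hCM hp1 gs tp hmem' hlen hrad (s ^ p) (by rw [htp]; exact hmem)
  -- downstairs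
  refine ⟨n, t', hn, ?_, mk s, ⟨1, ?_⟩, ?_⟩
  · rw [ht'.2]
    exact maximalIdeal.isMaximal _
  · -- `(mk s)^p ∈ (t̄)^[p]`
    have h2 : mk (s ^ p) ∈ (Ideal.ofList (gs ++ tp)).map mk := Ideal.mem_map_of_mem mk hsp
    rw [Ideal.ofList_append, Ideal.map_sup, hmk, Ideal.map_quotient_self, bot_sup_eq, htp, Exchange.ofList_ofFn,
      Ideal.map_span, map_pow] at h2
    rw [pow_one]
    refine Ideal.span_mono ?_ h2
    rintro _ ⟨_, ⟨i, rfl⟩, rfl⟩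
    refine ⟨t' i, Ideal.subset_span ⟨i, rfl⟩, ?_⟩
    change t' i ^ p = Ideal.Quotient.mk (Ideal.ofList gs) (t i ^ p)
    rw [map_pow, ← hmk, ht i]
  · -- `mk s ∉ (t̄)`
    intro hs
    exact hsI (hcomapI ▸ Ideal.mem_comap.mpr hs)

end Necessity

/-! ## §4 ★★ Fedder's criterion for complete intersections (both directions), and the transported negative half -/

/-- ★★ **FEDDER'S CRITERION FOR THE CRUX'S CLAUSE AT COMPLETE-INTERSECTION POINTS.** For a regular local ring `(R, 𝔪)` of
prime characteristic `p` and a finite list `gs ⊆ 𝔪` with `dim R⧸(gs) + |gs| = dim R`: the quotient `R ⧸ (gs)` satisfies the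
per-stalk clause of crux `FInjectiveMacaulayfication` — every system of parameters weakly regular and every parameter ideal
Frobenius closed, i.e. Cohen–Macaulay + F-injective — **iff** `(∏ gs)^(p-1) ∉ 𝔪^[p]`. (`⇐`: ✓ `CIFedder.fedder_ci_clause`, which
even gives all ideals Frobenius closed; `⇒`: `not_frobeniusClosed_of_ci_fedder_mem`.) [cite: Fedder1983, Thm. 1.12 and Prop. 2.1] -/
theorem ci_fedder_clause_iff (p : ℕ) [Fact p.Prime] (R : Type) [CommRing R] [IsRegularLocalRing R] [CharP R p]
    (gs : List R) (hgs : ∀ g ∈ gs, g ∈ maximalIdeal R)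
    (hdim : ringKrullDim (R ⧸ Ideal.ofList gs) + (gs.length : WithBot ℕ∞) = ringKrullDim R) :
    (∀ d : ℕ, ringKrullDim (R ⧸ Ideal.ofList gs) = d → ∀ s : Fin d → R ⧸ Ideal.ofList gs,
      (Ideal.span (Set.range s)).radical.IsMaximal →
        IsWeaklyRegular (R ⧸ Ideal.ofList gs) (List.ofFn s) ∧
        ∀ y : R ⧸ Ideal.ofList gs, (∃ e : ℕ, y ^ p ^ e ∈
            Ideal.span ((fun z : R ⧸ Ideal.ofList gs => z ^ p ^ e) ''
              (Ideal.span (Set.range s) : Set (R ⧸ Ideal.ofList gs)))) →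
          y ∈ Ideal.span (Set.range s)) ↔
      gs.prod ^ (p - 1) ∉ frobeniusPower p (maximalIdeal R) := by
  constructor
  · intro h hf
    obtain ⟨n, t, hn, ht, y, hy, hyt⟩ := not_frobeniusClosed_of_ci_fedder_mem p gs hgs hdim hf
    exact hyt ((h n hn t ht).2 y hy)
  · intro hf d hd s hs
    obtain ⟨hF, hW⟩ := CIFedder.fedder_ci_clause p R gs hgs hf hdim
    exact ⟨hW d hd s hs, fun y hy => hF _ y hy⟩

/-- ★ **The negative half, transported**: under the hypotheses of `not_frobeniusClosed_of_ci_fedder_mem`, NO ring `T` isomorphic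
to `R ⧸ (gs)` satisfies the per-stalk clause of the crux (✓ `DegreeZeroDescent.inlineClause_of_ringEquiv`). This is the form the
chart files consume (`T` = a localisation of `k[y]⧸(gs)` at a closed point, `R = k[y]_𝔪`). [cite: Fedder1983, Thm. 1.12 and Prop. 2.1] -/
theorem not_clause_of_ringEquiv_of_ci_fedder_mem (p : ℕ) [Fact p.Prime] (R : Type) [CommRing R] [IsRegularLocalRing R]
    [CharP R p] (gs : List R) (hgs : ∀ g ∈ gs, g ∈ maximalIdeal R)
    (hdim : ringKrullDim (R ⧸ Ideal.ofList gs) + (gs.length : WithBot ℕ∞) = ringKrullDim R)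
    (hfed : gs.prod ^ (p - 1) ∈ frobeniusPower p (maximalIdeal R)) {T : Type} [CommRing T]
    (e : T ≃+* R ⧸ Ideal.ofList gs) :
    ¬ (∀ d : ℕ, ringKrullDim T = d → ∀ s : Fin d → T, (Ideal.span (Set.range s)).radical.IsMaximal →
        IsWeaklyRegular T (List.ofFn s) ∧
        ∀ y : T, (∃ e : ℕ, y ^ p ^ e ∈ Ideal.span ((fun z : T => z ^ p ^ e) '' (Ideal.span (Set.range s) : Set T))) →
          y ∈ Ideal.span (Set.range s)) := by
  intro hT
  exact (ci_fedder_clause_iff p R gs hgs hdim).mp (DegreeZeroDescent.inlineClause_of_ringEquiv p e hT) hfed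

end Summit.ResolutionOfSingularities.ResolutionOfSingularities.Theorems.FInjectiveMacaulayfication.CIFedderNecessity
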